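import Summits.ABC.StewartYu.PadicG3ParVE
import HarnessLib

/-!
# The `p`-adic Gen-3 parameter record v2 (corrected family `…V`) — part VG: ceilings (upper bounds of the scales)

Support file (plain theorems; no named facts). The closed forms of `PadicG3ParV` are maxima of ceilings; the
headline lemma (`8·2ⁿ·Zp + CondFloorV n ≤ C(n)·(p/log p)·Ω·W⁺` at `m = 0`) needs them bounded ABOVE by the sum
of their branches. This file records those ceilings, each branch named:
* `LgV ≤ 24 C_bⁿ Ω K yloadG/(G gⁿ) + 2^{n+25} + (2Amax+1)/g + 4(ŜG+2) + 2`, `LV ≤ g·LgV`;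
* `W_LV ≤ W + log LV + 3`; `XV ≤ 64(n+1)W_LV/G + (3/2)(n+1)LgV g^{n−1}/(C_bⁿΩK) + 64(n+1) + 2`;
* `HV ≤ G·XV/(64(n+1))` (VB), `XsV s ≤ 2^s g XV/2 + 1` (VA), `L0V < 6XV C_bⁿΩK/g^{n−1} + 1` (V), `TV s ≤ 8 LgV` (V);
* `Zp = G·g·XV·LgV` with `G = θm·log p`, `g = G/(8(n+1))`; `MV = 16(n+1)LgV`; `2^{ŜG} ≤ 2^{n+24}·N_q·2^{lgg}`, `2^{lgg} < 4g`.

## References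
* [Nesterenko2003] Yu. V. Nesterenko, LNM 1819 (2003) — §3.5, §5.2.
* [Yu2013] K. Yu, Acta Math. 211 (2013) — §3.1.
-/

noncomputable section

open Finset Real

namespace Summit.ABC.StewartYu

namespace PadicG3Par

variable {n : ℕ} (P : PadicG3Par n)

/-- `⌈x⌉₊ ≤ x + 1` for `0 ≤ x` (real form). [folklore] -/
theorem natCeil_le_add_one {x : ℝ} (hx : 0 ≤ x) : (⌈x⌉₊ : ℝ) ≤ x + 1 := (Nat.ceil_lt_add_one hx).le

/-- **`LgV ≤ 24 C_bⁿ Ω K yloadG/(G gⁿ) + 2^{n+25} + (2Amax+1)/g + 4(ŜG+2) + 2`**. [folklore] -/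
theorem LgV_le : (P.LgV : ℝ) ≤ 24 * Cb ^ n * P.Ω * P.K * P.yloadG / (P.G * P.g ^ n) + 2 ^ (n + 25) +
    (2 * P.Amax + 1) / P.g + 4 * (P.SdG + 2) + 2 := by
  have hg0 : 0 < P.g := lt_of_lt_of_le one_pos P.one_le_g
  have hG : 0 < P.G := by linarith [P.eight_le_G]
  have hc : 0 ≤ 24 * Cb ^ n * P.Ω * P.K * P.yloadG / (P.G * P.g ^ n) := by
    have := P.Ω_pos; have := P.K_pos; have := P.yloadG_pos; have : (0:ℝ) < Cb := Cb_pos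
    positivity
  have hA0 : 0 ≤ P.Amax := le_trans (P.A_pos ⟨0, by have := P.hn; omega⟩).le (P.hAmax _)
  have hA : 0 ≤ (2 * P.Amax + 1) / P.g := by positivity
  have h1 := natCeil_le_add_one hc
  have h2 := natCeil_le_add_one hA
  have key : P.LgV ≤ ⌈24 * Cb ^ n * P.Ω * P.K * P.yloadG / (P.G * P.g ^ n)⌉₊ + 2 ^ (n + 25) +
      (⌈(2 * P.Amax + 1) / P.g⌉₊ + 4 * (P.SdG + 2)) := by
    unfold LgV
    refine max_le ?_ ?_
    · exact le_trans (max_le (Nat.le_add_right _ _) (Nat.le_add_left _ _)) (Nat.le_add_right _ _)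
    · exact le_trans (max_le (Nat.le_add_right _ _) (Nat.le_add_left _ _)) (Nat.le_add_left _ _)
  have key' : (P.LgV : ℝ) ≤ (⌈24 * Cb ^ n * P.Ω * P.K * P.yloadG / (P.G * P.g ^ n)⌉₊ : ℝ) + 2 ^ (n + 25) +
      ((⌈(2 * P.Amax + 1) / P.g⌉₊ : ℝ) + 4 * (P.SdG + 2)) := by exact_mod_cast key
  linarith

/-- **`W_LV ≤ W + log LV + 3`** (`1 + 2 e^W LV ≤ 3 e^W LV`, `log 3 < 2`). [folklore] -/
theorem WLV_le : P.WLV ≤ P.W + Real.log P.LV + 3 := by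
  rw [P.WLV_eq]
  have hL : (1 : ℝ) ≤ P.LV := P.one_le_LV
  have hW : 1 ≤ Real.exp P.W := by have := Real.add_one_le_exp P.W; linarith [P.hW]
  have hpos : 0 < 1 + 2 * Real.exp P.W * P.LV := by positivity
  have h3 : 1 + 2 * Real.exp P.W * P.LV ≤ 3 * (Real.exp P.W * P.LV) := by nlinarith
  have h4 : Real.log (1 + 2 * Real.exp P.W * P.LV) ≤ Real.log (3 * (Real.exp P.W * P.LV)) :=
    Real.log_le_log hpos h3
  rw [Real.log_mul (by norm_num) (by positivity), Real.log_mul (by positivity) (by positivity), Real.log_exp] at h4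
  have hl3 : Real.log 3 < 2 := by
    have := Real.log_lt_sub_one_of_pos (show (0:ℝ) < 3 by norm_num) (by norm_num); linarith
  linarith

/-- **`XV ≤ 64(n+1) W_LV/G + (3/2)(n+1) LgV g^{n−1}/(C_bⁿ Ω K) + 64(n+1) + 2`**. [folklore] -/
theorem XV_le : (P.XV : ℝ) ≤ 64 * (n + 1) * P.WLV / P.G + (3 / 2) * (n + 1) * P.LgV * P.g ^ (n - 1) / (Cb ^ n * P.Ω * P.K) +
    64 * (n + 1) + 2 := by
  have hG : 0 < P.G := by linarith [P.eight_le_G]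
  have hg0 : 0 < P.g := lt_of_lt_of_le one_pos P.one_le_g
  have hW : 0 ≤ P.WLV := by linarith [P.WLV_ge_one]
  have ha : 0 ≤ 64 * (n + 1) * P.WLV / P.G := by positivity
  have hb : 0 ≤ (3 / 2) * (n + 1) * P.LgV * P.g ^ (n - 1) / (Cb ^ n * P.Ω * P.K) := by
    have := P.Ω_pos; have := P.K_pos; have : (0:ℝ) < Cb := Cb_pos
    positivity
  have h1 := natCeil_le_add_one ha
  have h2 := natCeil_le_add_one hb
  have key : P.XV ≤ ⌈64 * (n + 1) * P.WLV / P.G⌉₊ + ⌈(3 / 2) * (n + 1) * P.LgV * P.g ^ (n - 1) / (Cb ^ n * P.Ω * P.K)⌉₊ +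
      64 * (n + 1) := by
    unfold XV
    exact max_le (le_trans (max_le (Nat.le_add_right _ _) (Nat.le_add_left _ _)) (Nat.le_add_right _ _))
      (Nat.le_add_left _ _)
  have key' : (P.XV : ℝ) ≤ (⌈64 * (n + 1) * P.WLV / P.G⌉₊ : ℝ) +
      (⌈(3 / 2) * (n + 1) * P.LgV * P.g ^ (n - 1) / (Cb ^ n * P.Ω * P.K)⌉₊ : ℝ) + 64 * (n + 1) := by
    exact_mod_cast key
  linarith

/-- `Zp = G·g·XV·LgV` with `g = G/(8(n+1))`: `Zp = G²·XV·LgV/(8(n+1))`. [folklore] -/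
theorem Zp_eq : P.Zp = P.G ^ 2 * P.XV * P.LgV / (8 * (n + 1)) := by
  have hG := P.G_eq_mul_g
  unfold Zp
  rw [eq_div_iff (by positivity), hG]
  ring

/-- `2^{lgg} < 4 g` (`2^{clog₂ ⌈g⌉} < 2⌈g⌉ ≤ 2(g+1) ≤ 4g`). [folklore] -/
theorem two_pow_lgg_lt : (2 : ℝ) ^ P.lgg < 4 * P.g := by
  have hg := P.one_le_g
  have hgc : 1 ≤ P.gceil := Nat.ceil_pos.mpr (by linarith)
  -- `2^{clog 2 x} < 2 x` for `x ≥ 1`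
  have h1 : 2 ^ P.lgg < 2 * P.gceil := by
    unfold lgg
    rcases Nat.eq_or_lt_of_le hgc with h | h
    · rw [← h]; simp
    · have hlt : 2 ^ (Nat.clog 2 P.gceil - 1) < P.gceil := by
        have := Nat.pow_pred_clog_lt_self (b := 2) (by norm_num) h
        rwa [Nat.pred_eq_sub_one] at this
      have hc : 1 ≤ Nat.clog 2 P.gceil := Nat.clog_pos (by norm_num) h
      have e : 2 ^ Nat.clog 2 P.gceil = 2 ^ (Nat.clog 2 P.gceil - 1) * 2 := by
        rw [← pow_succ, Nat.sub_add_cancel hc]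
      rw [e]; omega
  have h2 : (P.gceil : ℝ) < P.g + 1 := Nat.ceil_lt_add_one (by linarith)
  have h1' : ((2 ^ P.lgg : ℕ) : ℝ) < ((2 * P.gceil : ℕ) : ℝ) := by exact_mod_cast h1
  push_cast at h1'
  linarith

/-- `2^{ŜG} < 2^{n+26} · N_q · g`. [folklore] -/
theorem two_pow_SdG_lt : (2 : ℝ) ^ P.SdG < 2 ^ (n + 26) * P.Nq * P.g := by
  have h1 : (2 : ℝ) ^ P.SdG ≤ 2 ^ (n + 24) * P.Nq * 2 ^ P.lgg := by exact_mod_cast P.two_pow_SdG_le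
  have h2 := P.two_pow_lgg_lt
  have hNq : (0 : ℝ) < P.Nq := by exact_mod_cast P.hNq
  have h0 : (0 : ℝ) < 2 ^ (n + 24) * P.Nq := by positivity
  have e : (2 : ℝ) ^ (n + 26) = 2 ^ (n + 24) * 4 := by ring
  rw [e]
  nlinarith [mul_lt_mul_of_pos_left h2 h0]

/-- **`CondFloorV ν ≤ 2^{ν+n+27} · N_q · g² · XV · (log p/(p−1))`**. [folklore] -/
theorem CondFloorV_le (ν : ℕ) :
    P.CondFloorV ν ≤ 2 ^ (ν + n + 27) * P.Nq * P.g ^ 2 * P.XV * (Real.log P.p / (P.p - 1)) := by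
  unfold CondFloorV
  have h := P.two_pow_SdG_lt
  obtain ⟨_, hκ0⟩ := P.kappa_le_one
  have hg : 0 ≤ P.g := by linarith [P.one_le_g]
  have hX : (0 : ℝ) ≤ P.XV := by positivity
  have h0 : 0 ≤ (2 : ℝ) ^ (ν + 1) * P.g * P.XV * (Real.log P.p / (P.p - 1)) := by positivity
  have e : (2 : ℝ) ^ (ν + n + 27) * P.Nq * P.g ^ 2 * P.XV * (Real.log P.p / (P.p - 1)) =
      (2 ^ (n + 26) * P.Nq * P.g) * (2 ^ (ν + 1) * P.g * P.XV * (Real.log P.p / (P.p - 1))) := by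
    rw [show ν + n + 27 = (n + 26) + (ν + 1) by omega, pow_add]; ring
  rw [e]
  calc (2 : ℝ) ^ (ν + 1) * 2 ^ P.SdG * P.g * P.XV * (Real.log P.p / (P.p - 1))
      = 2 ^ P.SdG * (2 ^ (ν + 1) * P.g * P.XV * (Real.log P.p / (P.p - 1))) := by ring
    _ ≤ (2 ^ (n + 26) * P.Nq * P.g) * (2 ^ (ν + 1) * P.g * P.XV * (Real.log P.p / (P.p - 1))) :=
        mul_le_mul_of_nonneg_right h.le h0

end PadicG3Par

end Summit.ABC.StewartYu
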